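/-
Copyright (c) 2026 the pub-hodgecm-mathlib formalisation cell (harness21).  Prover seat hodgecm-mathlib-F0P2-p02 (g12), 2026-09-01.  Road «S3-tree» (architect A-p16 (g30)
A-160), the LIFT `_le_one ↦ _le_two`, organ (I) `stub_liftInterior` of the fold `LocalTransferAtOneHyperspecialLevelTwo`, N6 «THE ASSEMBLY» — TYPE-(1) BRANCH.
-/
import Literature.NumberTheory.Rogawski1990.TypeOneCayleyShiftBindersCM                 -- ★ N1∕N4 p846612 (this lineage): `isUnit_shift_denominators_of_disc_lt`, `shifted_binders_of_typeOne`, `not_levi_of_shift`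
import Literature.NumberTheory.Rogawski1990.FinExplicitTransferFactorCayleyShiftSum         -- ★ (A3) p846531 (this lineage): `finsum_finExplicitCollection_Δ_mul_eq_inv_sq_mul_finsum_shift`; brings ★ `TypeTwoCayleyShiftCM`
import Literature.NumberTheory.Rogawski1990.DepthZeroTransferHValuesShift                   -- ★ p846474 (END F0P3a-p03): the `S`-rows `stableOrbitalIntegralRel_chi_shift_of_isRoot`
import Literature.NumberTheory.Rogawski1990.FinExplicitTransferFactorInertExponentSplitStub  -- ★ `exists_flicker_exponents_split`
import Literature.NumberTheory.Rogawski1990.FinExplicitTransferFactorResiduallyRegular        -- ★ `charpoly_map_endoEmbLocal_apply`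
import Literature.NumberTheory.Rogawski1990.LeviNearOneTwoDeep                               -- ★ p846644 (F0P3a-p04): `valued_sub_one_le_of_isRoot_charpoly_of_congr_one`
import Literature.NumberTheory.Automorphic.NonsplitPlaceHaarBallRatios                       -- ★ `isUnit_toLocalRing_uniformizer`, `conjLocal_toLocalRing_uniformizer`, `valued_toLocalRing_uniformizer_apply`
import HarnessLib

/-!
# The LIFT's interior organ, TYPE (1): the Cayley shift `u_H = φ_ϖ(γ_H)` of a 2-deep `G`-regular non-Levi `γ_H` whose `χ_{g_w}` splits,
# with every binder the `S`-rows and the `Δ‴`-transport consume (Rogawski 1990 §4.9 Prop. 4.9.1 (a); Kottwitz 1986 §3)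

Topic `NumberTheory/Rogawski1990`; namespace `Literature.NumberTheory.Rogawski1990`.  THEOREMS ONLY (no definition, no instance, no notation, no named fact, no `sorry`);
kernel lane `--supports stmt-HodgeConjecture-24833`.  Cell `pub/hodgecm-mathlib` (D-0151), crux H413; road «S3-tree», the LIFT `_le_one ↦ _le_two`, organ (I) `stub_liftInterior`
of END F0P3a-p03 (g16)'s fold `LocalTransferAtOneHyperspecialLevelTwo` v3.5 :530, N6 «THE ASSEMBLY by cases type (1)∕(2)» — this file is the TYPE-(1) BRANCH (architect
A-p16 (g30) A-160; companion of ★ `exists_shifted_pair_of_typeTwo` (F0P2-p06 (g10)), whose §1 is the template of §3 here).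
HONEST LABEL: HC_CM is proved only modulo the 2 remaining named inputs (hLiu418 24832, h413 24833) until rung 0 closes; nothing printed is asserted here.

THE MATHEMATICS.  `w ∣ v` the place of the CM field `L` over a non-split place `v ∤ 2` of `L⁺` unramified in `L`, `c = ι_v(ϖ_v) ∈ E_v = ∏_{w ∣ v} L_w` (`σ(c) = c`,
`|c_w|_w = exp(−1)`), `γ_H = (g, u) ∈ H_v = U(Φ₂) × U(Φ₁)` `G`-regular with `ι_v(γ_H)_w ≡ 1 (mod ϖ_w²)` entrywise and `χ_{g_w}` SPLIT over `L_w` (type (1)).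
§1: the entries of `ι_v(γ_H)_w − 1` are those of `g_w − 1`, `u_w − 1` and zeros (★ `coe_endoGL_eq`).  §2 (root data): the roots `α ≠ γ` of `χ_{g_w}` and `u_w` are pairwise
distinct (`G`-regularity = separability of `χ_{g_w}(X − u_w)`, ★ `exists_flicker_exponents_split`), all `≡ 1 (mod ϖ_w²)` (eigenvalues of a matrix `≡ 1 (mod ϖ²)`, ★
`valued_sub_one_le_of_isRoot_charpoly_of_congr_one`), so `|α − γ| = exp(−N)` with `N ≥ 2` and `|χ_g(u)|_w = |u − α||u − γ| = exp(−n)` with `n ≥ 2`.  §3 (the shift): the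
Möbius denominators are units (★ `isUnit_shift_denominators_of_disc_lt`, `|disc χ_{g_w}| = exp(−2N) < exp(−2)`), so `u_H = (φ_c g, φ_c u)` exists on the carriers (★
`exists_local_coe_eq_moebius`); it is `G`-regular with split `χ` at depth `N − 1` and `|χ_{g′}(u′)|_w = exp(−(n−2))` (★ `shifted_binders_of_typeOne`), non-Levi (★
`not_levi_of_shift`), and the `3 × 3` denominators of `ι_v(γ_H)` are units.  §4: hence the two `S`-rows `Φ^st(u_H, χ₀) = Φ^st(γ_H, χ₀) − q⁻¹Φ^st(γ_H, χ₁)`,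
`Φ^st(u_H, χ₁) = q⁻¹Φ^st(γ_H, χ₁)` (★ `stableOrbitalIntegralRel_chi_shift_of_isRoot`) and the transport `Σ_c Δ‴(γ_H,c)F(c) = q⁻²Σ_c Δ‴(u_H,c)F′(c)` for every pair `(F, F′)`
agreeing along the shift of matching classes (★ (A3)).

## References
* [Rogawski1990] J. D. Rogawski, *Automorphic Representations of Unitary Groups in Three Variables*, Ann. of Math. Stud. 123 (1990), §4.9 Prop. 4.9.1 (a)(b) p. 55; §4.3
  (4.3.1)–(4.3.2) p. 43; §3.1 p. 19.
* [Kottwitz1986] R. E. Kottwitz, *Base change for unit elements of Hecke algebras*, Compositio Math. 60 (1986), §3.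
* [Flicker1998UnitaryFL] Y. Z. Flicker, *Elementary proof of the fundamental lemma for a unitary group*, Canad. J. Math. 50 (1998), §6 p. 97.
* [CasselsFrohlichANT1967] J. W. S. Cassels, A. Fröhlich (eds.), *Algebraic Number Theory* (1967), Ch. II §10.
-/

set_option autoImplicit false

noncomputable section

open MeasureTheory Measure NumberField IsDedekindDomain Matrix Polynomial
open scoped MatrixGroups WithZero

namespace Literature.NumberTheory.Rogawski1990

open Literature.NumberTheory.Automorphic Literature.NumberTheory.Automorphic.UnitaryGroup Literature.NumberTheory.Automorphic.MoebiusShift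
open Literature.NumberTheory.Automorphic.IntegralReduction
open Literature.NumberTheory.GaloisRepresentations Literature.NumberTheory.NumberFields

variable (L : Type) [Field L] [NumberField L] [IsCMField L] (v : HeightOneSpectrum (𝓞 ↥(maximalRealSubfield L))) (w : PlacesOver L v)
  (hw : IsCMField.complexConj L • w.1 = w.1)

/-! ## §1 The entries of `ι_v(γ_H)_w − 1` -/

/-- **The entries of `ι_v(γ_H)_w − 1`** are `(g_w − 1)_{00}, (g_w − 1)_{01}, (g_w − 1)_{10}, (g_w − 1)_{11}` at `(0,0), (0,2), (2,0), (2,2)`, `u_w − 1` at `(1,1)`, and `0`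
elsewhere (★ `coe_endoGL_eq`: `ι(g, u) = (g₀₀ 0 g₀₁; 0 u 0; g₁₀ 0 g₁₁)`); hence an entrywise bound `≤ t` on `g_w − 1` and `u_w − 1` is one on `ι_v(γ_H)_w − 1`.
[cite: Rogawski1990, §4.8 Case (a) p. 53] -/
theorem forall_valued_endoEmbLocal_sub_one_le_of_blocks
    (γH : (cmDatum L 2 (Matrix.of fun i j : Fin 2 => if i.val + j.val + 1 = 2 then (1 : L) else 0)).Local v ×
      (cmDatum L 1 (Matrix.of fun i j : Fin 1 => if i.val + j.val + 1 = 1 then (1 : L) else 0)).Local v)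
    {t : ℤᵐ⁰}
    (hg : ∀ i k, Valued.v ((((γH.1.val : GL (Fin 2) (LocalRing L v)).val.map (Pi.evalRingHom (fun w' : PlacesOver L v => w'.1.adicCompletion L) w)) - 1) i k) ≤ t)
    (hu : Valued.v (finGammaTwo L v γH w - 1) ≤ t) :
    ∀ a b, Valued.v (((((endoEmbLocal L v γH).val : GL (Fin 3) (LocalRing L v)).val.map
        (Pi.evalRingHom (fun w' : PlacesOver L v => w'.1.adicCompletion L) w)) - 1) a b) ≤ t := by
  have h0 : (0 : ℤᵐ⁰) ≤ t := zero_le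
  have hι : (((endoEmbLocal L v γH).val : GL (Fin 3) (LocalRing L v)).val.map (Pi.evalRingHom (fun w' : PlacesOver L v => w'.1.adicCompletion L) w)) =
      !![((γH.1.val : GL (Fin 2) (LocalRing L v)).val.map (Pi.evalRingHom (fun w' : PlacesOver L v => w'.1.adicCompletion L) w)) 0 0, 0,
          ((γH.1.val : GL (Fin 2) (LocalRing L v)).val.map (Pi.evalRingHom (fun w' : PlacesOver L v => w'.1.adicCompletion L) w)) 0 1;
        0, finGammaTwo L v γH w, 0;
        ((γH.1.val : GL (Fin 2) (LocalRing L v)).val.map (Pi.evalRingHom (fun w' : PlacesOver L v => w'.1.adicCompletion L) w)) 1 0, 0,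
          ((γH.1.val : GL (Fin 2) (LocalRing L v)).val.map (Pi.evalRingHom (fun w' : PlacesOver L v => w'.1.adicCompletion L) w)) 1 1] := by
    rw [coe_endoEmbLocal, coe_endoGL_eq]
    ext a b; fin_cases a <;> fin_cases b <;> simp [finGammaTwo]
  intro a b
  rw [hι]
  fin_cases a <;> fin_cases b
  · simpa [Matrix.sub_apply, Matrix.one_apply] using hg 0 0
  · simp [Matrix.sub_apply, h0]
  · simpa [Matrix.sub_apply, Matrix.one_apply] using hg 0 1
  · simp [Matrix.sub_apply, h0]
  · simpa [Matrix.sub_apply, Matrix.one_apply] using hu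
  · simp [Matrix.sub_apply, h0]
  · simpa [Matrix.sub_apply, Matrix.one_apply] using hg 1 0
  · simp [Matrix.sub_apply, h0]
  · simpa [Matrix.sub_apply, Matrix.one_apply] using hg 1 1

/-- Conversely, an entrywise bound on `ι_v(γ_H)_w − 1` gives the same bound on `g_w − 1` and `u_w − 1`. [cite: Rogawski1990, §4.8 Case (a) p. 53] -/
theorem forall_valued_blocks_sub_one_le_of_endoEmbLocal
    (γH : (cmDatum L 2 (Matrix.of fun i j : Fin 2 => if i.val + j.val + 1 = 2 then (1 : L) else 0)).Local v ×
      (cmDatum L 1 (Matrix.of fun i j : Fin 1 => if i.val + j.val + 1 = 1 then (1 : L) else 0)).Local v)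
    {t : ℤᵐ⁰}
    (hdeep : ∀ a b, Valued.v (((((endoEmbLocal L v γH).val : GL (Fin 3) (LocalRing L v)).val.map
        (Pi.evalRingHom (fun w' : PlacesOver L v => w'.1.adicCompletion L) w)) - 1) a b) ≤ t) :
    (∀ i k, Valued.v ((((γH.1.val : GL (Fin 2) (LocalRing L v)).val.map (Pi.evalRingHom (fun w' : PlacesOver L v => w'.1.adicCompletion L) w)) - 1) i k) ≤ t) ∧
      Valued.v (finGammaTwo L v γH w - 1) ≤ t := by
  have hι : (((endoEmbLocal L v γH).val : GL (Fin 3) (LocalRing L v)).val.map (Pi.evalRingHom (fun w' : PlacesOver L v => w'.1.adicCompletion L) w)) =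
      !![((γH.1.val : GL (Fin 2) (LocalRing L v)).val.map (Pi.evalRingHom (fun w' : PlacesOver L v => w'.1.adicCompletion L) w)) 0 0, 0,
          ((γH.1.val : GL (Fin 2) (LocalRing L v)).val.map (Pi.evalRingHom (fun w' : PlacesOver L v => w'.1.adicCompletion L) w)) 0 1;
        0, finGammaTwo L v γH w, 0;
        ((γH.1.val : GL (Fin 2) (LocalRing L v)).val.map (Pi.evalRingHom (fun w' : PlacesOver L v => w'.1.adicCompletion L) w)) 1 0, 0,
          ((γH.1.val : GL (Fin 2) (LocalRing L v)).val.map (Pi.evalRingHom (fun w' : PlacesOver L v => w'.1.adicCompletion L) w)) 1 1] := by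
    rw [coe_endoEmbLocal, coe_endoGL_eq]
    ext a b; fin_cases a <;> fin_cases b <;> simp [finGammaTwo]
  have h := hdeep
  rw [hι] at h
  refine ⟨fun i k => ?_, ?_⟩
  · fin_cases i <;> fin_cases k
    · simpa [Matrix.sub_apply, Matrix.one_apply] using h 0 0
    · simpa [Matrix.sub_apply, Matrix.one_apply] using h 0 2
    · simpa [Matrix.sub_apply, Matrix.one_apply] using h 2 0
    · simpa [Matrix.sub_apply, Matrix.one_apply] using h 2 2
  · simpa [Matrix.sub_apply, Matrix.one_apply] using h 1 1


/-! ## §2 Type (1): the root data of a 2-deep `G`-regular `γ_H` whose `χ_{g_w}` splits -/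

include hw in
set_option maxHeartbeats 800000 in
-- the carriers' types are large
/-- **ROOT DATA, TYPE (1).**  For a `G`-regular `γ_H = (g, u)` with `ι_v(γ_H)_w ≡ 1 (mod ϖ_w²)` entrywise whose `χ_{g_w}` has a root in `L_w`: `χ_{g_w}` has two roots
`α ≠ γ` (the second root of the monic quadratic; distinct from each other and from `u_w` by `G`-regularity = separability of `χ_{g_w}·(X − u_w)`, ★
`exists_flicker_exponents_split`), `|α − 1|, |γ − 1| ≤ exp(−2)` (eigenvalues of a matrix `≡ 1 (mod ϖ²)`, ★ `valued_sub_one_le_of_isRoot_charpoly_of_congr_one` on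
`ι_v(γ_H)_w`), hence `|α − γ| = exp(−N)` with `N ≥ 2`, and `|χ_g(u)|_w = |u_w − α|·|u_w − γ| = exp(−n)` with `n ≥ 2`.
[cite: Rogawski1990, §4.9 Prop. 4.9.1 (a) p. 55; §3.1 p. 19] [cite: Flicker1998UnitaryFL, §6 p. 97] [cite: CasselsFrohlichANT1967, Ch. II §10] -/
theorem exists_typeOne_root_data_of_twoDeep
    (γH : (cmDatum L 2 (Matrix.of fun i j : Fin 2 => if i.val + j.val + 1 = 2 then (1 : L) else 0)).Local v ×
      (cmDatum L 1 (Matrix.of fun i j : Fin 1 => if i.val + j.val + 1 = 1 then (1 : L) else 0)).Local v)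
    (hreg : IsLocalGRegular L v γH)
    (hsplit : ∃ x : w.1.adicCompletion L, (((γH.1.val : GL (Fin 2) (LocalRing L v)).val.map
        (Pi.evalRingHom (fun w' : PlacesOver L v => w'.1.adicCompletion L) w)).charpoly).IsRoot x)
    (hdeep : ∀ a b, Valued.v (((((endoEmbLocal L v γH).val : GL (Fin 3) (LocalRing L v)).val.map
        (Pi.evalRingHom (fun w' : PlacesOver L v => w'.1.adicCompletion L) w)) - 1) a b) ≤ WithZero.exp (-2 : ℤ)) :
    ∃ (α γ : w.1.adicCompletion L) (N n : ℕ),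
      ((((γH.1.val : GL (Fin 2) (LocalRing L v)) : Matrix (Fin 2) (Fin 2) (LocalRing L v)).charpoly).map
        (Pi.evalRingHom (fun w' : PlacesOver L v => w'.1.adicCompletion L) w)).IsRoot α ∧
      ((((γH.1.val : GL (Fin 2) (LocalRing L v)) : Matrix (Fin 2) (Fin 2) (LocalRing L v)).charpoly).map
        (Pi.evalRingHom (fun w' : PlacesOver L v => w'.1.adicCompletion L) w)).IsRoot γ ∧
      α ≠ γ ∧ Valued.v (α - γ) = WithZero.exp (-(N : ℤ)) ∧ 2 ≤ N ∧
      Valued.v (α - 1) ≤ WithZero.exp (-2 : ℤ) ∧ Valued.v (γ - 1) ≤ WithZero.exp (-2 : ℤ) ∧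
      Valued.v (((finCharpolyTwo L v γH).eval (finGammaTwo L v γH)) w) = WithZero.exp (-(n : ℤ)) ∧ 2 ≤ n := by
  set evw : LocalRing L v →+* w.1.adicCompletion L := Pi.evalRingHom (fun w' : PlacesOver L v => w'.1.adicCompletion L) w with hevw
  set ιw : Matrix (Fin 3) (Fin 3) (w.1.adicCompletion L) := (((endoEmbLocal L v γH).val : GL (Fin 3) (LocalRing L v)).val.map evw) with hιw
  set gw : Matrix (Fin 2) (Fin 2) (w.1.adicCompletion L) := ((γH.1.val : GL (Fin 2) (LocalRing L v)).val.map evw) with hgw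
  set uw : w.1.adicCompletion L := finGammaTwo L v γH w with huw
  obtain ⟨ϖ, hϖ⟩ := exists_uniformizer_adicCompletion L v w
  have hϖ0 : ϖ ≠ 0 := fun h => by rw [h, map_zero] at hϖ; exact WithZero.coe_ne_zero hϖ.symm
  have hϖ2 : Valued.v (ϖ ^ 2) = WithZero.exp (-2 : ℤ) := by
    rw [Valuation.map_pow, hϖ, ← WithZero.exp_nsmul]; norm_num
  have he2 : WithZero.exp (-2 : ℤ) ≤ 1 := by rw [← WithZero.exp_zero, WithZero.exp_le_exp]; norm_num
  -- the entries of `ι_v(γ_H)_w` are integral, hence so is its characteristic polynomial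
  have hB : ∀ a b, Valued.v (ιw a b) ≤ 1 := by
    intro a b
    have h := hdeep a b
    have e : ιw a b = (ιw - 1) a b + (1 : Matrix (Fin 3) (Fin 3) (w.1.adicCompletion L)) a b := by
      rw [Matrix.sub_apply, sub_add_cancel]
    rw [e]
    refine (Valuation.map_add _ _ _).trans (max_le (h.trans he2) ?_)
    by_cases hab : a = b
    · subst hab; rw [Matrix.one_apply_eq, map_one]
    · rw [Matrix.one_apply_ne hab, map_zero]; exact zero_le
  have hcoef : ∀ i : ℕ, Valued.v (ιw.charpoly.coeff i) ≤ 1 := by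
    let B₀ : Matrix (Fin 3) (Fin 3) ↥(Valued.v : Valuation (w.1.adicCompletion L) ℤᵐ⁰).integer :=
      Matrix.of fun a b => ⟨ιw a b, (Valuation.mem_integer_iff _ _).2 (hB a b)⟩
    have hB₀ : ιw = B₀.map (Valued.v : Valuation (w.1.adicCompletion L) ℤᵐ⁰).integer.subtype := by
      ext a b; rfl
    intro i
    rw [hB₀, Matrix.charpoly_map, Polynomial.coeff_map]
    exact (Valuation.mem_integer_iff _ _).1 (B₀.charpoly.coeff i).2
  have hint : ∀ i : ℕ, ιw.charpoly.coeff i ∈ Valued.integer (w.1.adicCompletion L) :=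
    fun i => (Valuation.mem_integer_iff _ _).2 (hcoef i)
  -- (1) the split eigen-data and the exponents (`G`-regularity)
  obtain ⟨α, γ, N₁, N₂, N, hα, hγ, hαγ, hN₁, hN₂, hN, -⟩ := exists_flicker_exponents_split L v w hw hreg hint hsplit
  -- (2) 2-deep eigenvalues
  have hdeep' : ∀ a b, Valued.v (ιw a b - (1 : Matrix (Fin 3) (Fin 3) (w.1.adicCompletion L)) a b) ≤ Valued.v (ϖ ^ 2) := fun a b => by
    rw [hϖ2, ← Matrix.sub_apply]; exact hdeep a b
  have hfac := charpoly_map_endoEmbLocal_apply L (w := w) (γH := γH)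
  have hcm : gw.charpoly = ((((γH.1.val : GL (Fin 2) (LocalRing L v)) : Matrix (Fin 2) (Fin 2) (LocalRing L v)).charpoly).map evw) := Matrix.charpoly_map _ _
  have hrootι : ∀ x : w.1.adicCompletion L,
      ((((γH.1.val : GL (Fin 2) (LocalRing L v)) : Matrix (Fin 2) (Fin 2) (LocalRing L v)).charpoly).map evw).IsRoot x → ιw.charpoly.IsRoot x := fun x hx => by
    rw [hιw, hfac, Polynomial.IsRoot, eval_mul, hcm, hx.eq_zero, zero_mul]
  have hα2 : Valued.v (α - 1) ≤ WithZero.exp (-2 : ℤ) := by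
    rw [← hϖ2]; exact valued_sub_one_le_of_isRoot_charpoly_of_congr_one ιw (pow_ne_zero 2 hϖ0) hdeep' (hrootι α hα)
  have hγ2 : Valued.v (γ - 1) ≤ WithZero.exp (-2 : ℤ) := by
    rw [← hϖ2]; exact valued_sub_one_le_of_isRoot_charpoly_of_congr_one ιw (pow_ne_zero 2 hϖ0) hdeep' (hrootι γ hγ)
  have hu2 : Valued.v (uw - 1) ≤ WithZero.exp (-2 : ℤ) := by
    rw [← hϖ2]
    refine valued_sub_one_le_of_isRoot_charpoly_of_congr_one ιw (pow_ne_zero 2 hϖ0) hdeep' ?_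
    rw [hιw, hfac, Polynomial.IsRoot, eval_mul, eval_sub, eval_X, eval_C, sub_self, mul_zero]
  -- (3) `N ≥ 2`
  have hsub2 : ∀ {x y : w.1.adicCompletion L}, Valued.v (x - 1) ≤ WithZero.exp (-2 : ℤ) → Valued.v (y - 1) ≤ WithZero.exp (-2 : ℤ) →
      Valued.v (x - y) ≤ WithZero.exp (-2 : ℤ) := fun {x y} hx hy => by
    rw [show x - y = (x - 1) - (y - 1) by ring]
    exact (Valuation.map_sub _ _ _).trans (max_le hx hy)
  have hle2 : ∀ {M : ℕ} {x : w.1.adicCompletion L}, Valued.v x = WithZero.exp (-(M : ℤ)) → Valued.v x ≤ WithZero.exp (-2 : ℤ) → 2 ≤ M :=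
    fun {M x} hx hle => by rw [hx, WithZero.exp_le_exp] at hle; omega
  have h2N : 2 ≤ N := hle2 hN (hsub2 hα2 hγ2)
  have h2N₁ : 2 ≤ N₁ := hle2 hN₁ (hsub2 hα2 hu2)
  have h2N₂ : 2 ≤ N₂ := hle2 hN₂ (hsub2 hγ2 hu2)
  -- (4) `|χ_g(u)|_w = |u − α|·|u − γ|`
  rw [← hcm] at hα hγ
  obtain ⟨htr, hdet, -⟩ := trace_det_disc_of_isRoot_of_isRoot gw hα hγ hαγ
  have hev : ((finCharpolyTwo L v γH).eval (finGammaTwo L v γH)) w = gw.charpoly.eval uw := by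
    have e : ((finCharpolyTwo L v γH).eval (finGammaTwo L v γH)) w = evw ((finCharpolyTwo L v γH).eval (finGammaTwo L v γH)) := rfl
    rw [e, ← Polynomial.eval₂_at_apply, ← Polynomial.eval_map, finCharpolyTwo, ← Matrix.charpoly_map]
    rfl
  have hevαγ : gw.charpoly.eval uw = (uw - α) * (uw - γ) := by
    rw [Matrix.charpoly_fin_two, htr, hdet]
    simp only [eval_add, eval_sub, eval_mul, eval_pow, eval_X, eval_C]
    ring
  have hn : Valued.v (((finCharpolyTwo L v γH).eval (finGammaTwo L v γH)) w) = WithZero.exp (-((N₁ + N₂ : ℕ) : ℤ)) := by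
    rw [hev, hevαγ, Valuation.map_mul, Valuation.map_sub_swap, hN₁, Valuation.map_sub_swap, hN₂, ← WithZero.exp_add]
    congr 1; push_cast; ring
  rw [hcm] at hα hγ
  exact ⟨α, γ, N, N₁ + N₂, hα, hγ, hαγ, hN, h2N, hα2, hγ2, hn, by omega⟩


/-! ## §3 Type (1): the Cayley shift `u_H = (φ_c g, φ_c u)` of a deep `γ_H`, with every binder -/

include hw in
set_option maxHeartbeats 1600000 in
-- the carriers' types are large terms
/-- **THE SHIFT PACKAGE, TYPE (1).**  `v` non-split (`σ • w = w`) unramified in `L`, `|2|_w = 1`, `c ∈ E_v` with `σ(c) = c`, `|c_w| = exp(−1)`; `γ_H = (g, u) ∈ H_v`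
`G`-regular, not `H_v`-conjugate to a diagonal torus element, with `χ_{g_w}` split over `L_w` and `g_w ≡ 1`, `u_w ≡ 1 (mod c_w^{j+1})` entrywise, `j ≥ 1`.  Then there are
`u_H ∈ H_v`, roots `α ≠ γ` of `χ_{g_w}` and `α′ ≠ γ′` of `χ_{g′_w}`, and exponents `N, n ≥ 2` such that: `u_H = (φ_c g, φ_c u)` on matrices (`h1 h2′`) and
`u′ = ((c+1)u + (c−1))·((c−1)u + (c+1))⁻¹` (`hu′`); the Möbius denominators `det((c−1)g + (c+1))`, `(c−1)u + (c+1)` (as `1 × 1` determinant and as scalar),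
`det((c∓1)ι_v(γ_H) + (c±1))` and `(c+1)² − (c−1)²` are units of `E_v`; `u_H` is `G`-regular and non-Levi; `|α − γ| = exp(−N)`, `|α′ − γ′| = exp(−(N−1))`, all four
roots `≡ 1 (mod 𝔪_w)`; `|χ_g(u)|_w = exp(−n)`, `|χ_{g′}(u′)|_w = exp(−(n−2))`, `log|χ_{g′}(u′)|_w = log|χ_g(u)|_w + 2` — exactly the binders of ★
`stableOrbitalIntegralRel_chi_shift_of_isRoot` (the `S`-rows) and of ★ `finsum_finExplicitCollection_Δ_mul_eq_inv_sq_mul_finsum_shift` (the `Δ‴`-transport) at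
`(γ_H, u_H)`, and of ★ `exists_level_forall_shift_mem_of_mem_nhds_one` (`u_H → 1`).  Twin of ★ `exists_shifted_pair_of_typeTwo` §1 on the `H`-side.
[cite: Rogawski1990, §4.9 Prop. 4.9.1 (a) p. 55; §4.3 (4.3.1) p. 43] [cite: Kottwitz1986, §3] [cite: Flicker1998UnitaryFL, §6 p. 97] -/
theorem exists_typeOne_shift (h2 : Valued.v (2 : w.1.adicCompletion L) = 1)
    {c : LocalRing L v} (hσc : conjLocal L (IsCMField.complexConj L) v c = c) (hc : Valued.v (c w) = WithZero.exp (-1 : ℤ))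
    {γH : (cmDatum L 2 (Matrix.of fun i j : Fin 2 => if i.val + j.val + 1 = 2 then (1 : L) else 0)).Local v ×
      (cmDatum L 1 (Matrix.of fun i j : Fin 1 => if i.val + j.val + 1 = 1 then (1 : L) else 0)).Local v}
    (hreg : IsLocalGRegular L v γH)
    (hell : ¬ ∃ (y : ((cmDatum L 2 (Matrix.of fun i j : Fin 2 => if i.val + j.val + 1 = 2 then (1 : L) else 0)).Local v ×
        (cmDatum L 1 (Matrix.of fun i j : Fin 1 => if i.val + j.val + 1 = 1 then (1 : L) else 0)).Local v)) (d' : Fin 2 → (UnitaryGroup.LocalRing L v)ˣ),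
        glDiagonal 2 (UnitaryGroup.LocalRing L v) d' = ((y * γH * y⁻¹).1.val : GL (Fin 2) (UnitaryGroup.LocalRing L v)))
    (hsplit : ∃ x : w.1.adicCompletion L, (((γH.1.val : GL (Fin 2) (LocalRing L v)).val.map
        (Pi.evalRingHom (fun w' : PlacesOver L v => w'.1.adicCompletion L) w)).charpoly).IsRoot x)
    {j : ℕ} (hj : 1 ≤ j)
    (hg : ∀ i k, Valued.v ((((γH.1.val : GL (Fin 2) (LocalRing L v)).val.map (Pi.evalRingHom (fun w' : PlacesOver L v => w'.1.adicCompletion L) w)) - 1) i k) ≤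
      Valued.v (c w) ^ (j + 1))
    (hu : Valued.v (finGammaTwo L v γH w - 1) ≤ Valued.v (c w) ^ (j + 1)) :
    ∃ (uH : (cmDatum L 2 (Matrix.of fun i j : Fin 2 => if i.val + j.val + 1 = 2 then (1 : L) else 0)).Local v ×
        (cmDatum L 1 (Matrix.of fun i j : Fin 1 => if i.val + j.val + 1 = 1 then (1 : L) else 0)).Local v)
      (α γ α' γ' : w.1.adicCompletion L) (N n : ℕ),
      -- the shift on matrices
      ((uH.1.val : GL (Fin 2) (LocalRing L v)).val : Matrix (Fin 2) (Fin 2) (LocalRing L v)) =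
        ((c + 1) • ((γH.1.val : GL (Fin 2) (LocalRing L v)).val : Matrix (Fin 2) (Fin 2) (LocalRing L v)) + (c - 1) • 1) *
          ((c - 1) • ((γH.1.val : GL (Fin 2) (LocalRing L v)).val : Matrix (Fin 2) (Fin 2) (LocalRing L v)) + (c + 1) • 1)⁻¹ ∧
      ((uH.2.val : GL (Fin 1) (LocalRing L v)).val : Matrix (Fin 1) (Fin 1) (LocalRing L v)) =
        ((c + 1) • ((γH.2.val : GL (Fin 1) (LocalRing L v)).val : Matrix (Fin 1) (Fin 1) (LocalRing L v)) + (c - 1) • 1) *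
          ((c - 1) • ((γH.2.val : GL (Fin 1) (LocalRing L v)).val : Matrix (Fin 1) (Fin 1) (LocalRing L v)) + (c + 1) • 1)⁻¹ ∧
      finGammaTwo L v uH = ((c + 1) * finGammaTwo L v γH + (c - 1)) * Ring.inverse ((c - 1) * finGammaTwo L v γH + (c + 1)) ∧
      -- the denominators are units
      IsUnit (((c - 1) • ((γH.1.val : GL (Fin 2) (LocalRing L v)).val : Matrix (Fin 2) (Fin 2) (LocalRing L v)) + (c + 1) • (1 : Matrix (Fin 2) (Fin 2) (LocalRing L v))).det) ∧
      IsUnit (((c - 1) • ((γH.2.val : GL (Fin 1) (LocalRing L v)).val : Matrix (Fin 1) (Fin 1) (LocalRing L v)) + (c + 1) • (1 : Matrix (Fin 1) (Fin 1) (LocalRing L v))).det) ∧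
      IsUnit ((c - 1) * finGammaTwo L v γH + (c + 1)) ∧
      IsUnit (((c - 1) • (((endoEmbLocal L v γH).val : GL (Fin 3) (LocalRing L v)).val : Matrix (Fin 3) (Fin 3) (LocalRing L v)) +
        (c + 1) • (1 : Matrix (Fin 3) (Fin 3) (LocalRing L v))).det) ∧
      IsUnit (((c + 1) • (((endoEmbLocal L v γH).val : GL (Fin 3) (LocalRing L v)).val : Matrix (Fin 3) (Fin 3) (LocalRing L v)) +
        (c - 1) • (1 : Matrix (Fin 3) (Fin 3) (LocalRing L v))).det) ∧
      IsUnit ((c + 1) ^ 2 - (c - 1) ^ 2) ∧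
      -- the shift is `G`-regular and non-Levi
      IsLocalGRegular L v uH ∧
      (¬ ∃ (y : ((cmDatum L 2 (Matrix.of fun i j : Fin 2 => if i.val + j.val + 1 = 2 then (1 : L) else 0)).Local v ×
        (cmDatum L 1 (Matrix.of fun i j : Fin 1 => if i.val + j.val + 1 = 1 then (1 : L) else 0)).Local v)) (d' : Fin 2 → (UnitaryGroup.LocalRing L v)ˣ),
        glDiagonal 2 (UnitaryGroup.LocalRing L v) d' = ((y * uH * y⁻¹).1.val : GL (Fin 2) (UnitaryGroup.LocalRing L v))) ∧
      -- the roots of `χ_{g_w}` and of `χ_{g′_w}`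
      ((((γH.1.val : GL (Fin 2) (LocalRing L v)) : Matrix (Fin 2) (Fin 2) (LocalRing L v)).charpoly).map
        (Pi.evalRingHom (fun w' : PlacesOver L v => w'.1.adicCompletion L) w)).IsRoot α ∧
      ((((γH.1.val : GL (Fin 2) (LocalRing L v)) : Matrix (Fin 2) (Fin 2) (LocalRing L v)).charpoly).map
        (Pi.evalRingHom (fun w' : PlacesOver L v => w'.1.adicCompletion L) w)).IsRoot γ ∧
      α ≠ γ ∧ Valued.v (α - γ) = WithZero.exp (-(N : ℤ)) ∧ 2 ≤ N ∧ Valued.v (α - 1) < 1 ∧ Valued.v (γ - 1) < 1 ∧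
      ((((uH.1.val : GL (Fin 2) (LocalRing L v)) : Matrix (Fin 2) (Fin 2) (LocalRing L v)).charpoly).map
        (Pi.evalRingHom (fun w' : PlacesOver L v => w'.1.adicCompletion L) w)).IsRoot α' ∧
      ((((uH.1.val : GL (Fin 2) (LocalRing L v)) : Matrix (Fin 2) (Fin 2) (LocalRing L v)).charpoly).map
        (Pi.evalRingHom (fun w' : PlacesOver L v => w'.1.adicCompletion L) w)).IsRoot γ' ∧
      α' ≠ γ' ∧ Valued.v (α' - γ') = WithZero.exp (-((N - 1 : ℕ) : ℤ)) ∧ Valued.v (α' - 1) < 1 ∧ Valued.v (γ' - 1) < 1 ∧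
      -- the depth sum
      Valued.v (((finCharpolyTwo L v γH).eval (finGammaTwo L v γH)) w) = WithZero.exp (-(n : ℤ)) ∧ 2 ≤ n ∧
      Valued.v (((finCharpolyTwo L v uH).eval (finGammaTwo L v uH)) w) = WithZero.exp (-((n - 2 : ℕ) : ℤ)) ∧
      WithZero.log (Valued.v (((finCharpolyTwo L v uH).eval (finGammaTwo L v uH)) w)) =
        WithZero.log (Valued.v (((finCharpolyTwo L v γH).eval (finGammaTwo L v γH)) w)) + 2 := by
  have hvs : Subsingleton (PlacesOver L v) := PlacesOver.subsingleton_of_smul_eq (IsCMField.complexConj L) (IsCMField.complexConj_ne_one L) w hw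
  set evw : LocalRing L v →+* w.1.adicCompletion L := Pi.evalRingHom (fun w' : PlacesOver L v => w'.1.adicCompletion L) w with hevw
  set gw : Matrix (Fin 2) (Fin 2) (w.1.adicCompletion L) := ((γH.1.val : GL (Fin 2) (LocalRing L v)).val.map evw) with hgw
  obtain ⟨hc0, hc1, -, -, -, -⟩ := shift_parameter_facts hc
  haveI : NeZero (2 : w.1.adicCompletion L) := ⟨fun h => by rw [h, map_zero] at h2; exact zero_ne_one h2⟩
  -- level `j + 1 ≥ 2` ⇒ level `1` and level `2`
  have hp1 : Valued.v (c w) ^ (j + 1) ≤ Valued.v (c w) := by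
    calc Valued.v (c w) ^ (j + 1) ≤ Valued.v (c w) ^ 1 := pow_le_pow_right_of_le_one' hc1.le (by omega)
      _ = Valued.v (c w) := pow_one _
  have hp2 : Valued.v (c w) ^ (j + 1) ≤ WithZero.exp (-2 : ℤ) := by
    calc Valued.v (c w) ^ (j + 1) ≤ Valued.v (c w) ^ 2 := pow_le_pow_right_of_le_one' hc1.le (by omega)
      _ = WithZero.exp (-2 : ℤ) := by rw [hc, ← WithZero.exp_nsmul]; norm_num
  have hg1 : ∀ i k, Valued.v ((((γH.1.val : GL (Fin 2) (LocalRing L v)).val.map evw) - 1) i k) ≤ Valued.v (c w) := fun i k => (hg i k).trans hp1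
  have hu1 : Valued.v (finGammaTwo L v γH w - 1) ≤ Valued.v (c w) := hu.trans hp1
  have hdeep : ∀ a b, Valued.v (((((endoEmbLocal L v γH).val : GL (Fin 3) (LocalRing L v)).val.map evw) - 1) a b) ≤ WithZero.exp (-2 : ℤ) :=
    forall_valued_endoEmbLocal_sub_one_le_of_blocks L v w γH (fun i k => (hg i k).trans hp2) (hu.trans hp2)
  -- §2: the root data
  obtain ⟨α, γ, N, n, hα, hγ, hαγ, hN, h2N, hα2, hγ2, hn, hn2⟩ := exists_typeOne_root_data_of_twoDeep L v w hw γH hreg hsplit hdeep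
  -- the discriminant `(α − γ)²` is deeper than `exp(−2)`, so the denominators are units (★ N1 §2)
  have hchar : ((((γH.1.val : GL (Fin 2) (LocalRing L v)) : Matrix (Fin 2) (Fin 2) (LocalRing L v)).charpoly).map evw) = gw.charpoly := by
    rw [hgw, Matrix.charpoly_map]
  have hαw : gw.charpoly.IsRoot α := by rw [← hchar]; exact hα
  have hγw : gw.charpoly.IsRoot γ := by rw [← hchar]; exact hγ
  obtain ⟨-, -, hdiscg⟩ := trace_det_disc_of_isRoot_of_isRoot gw hαw hγw hαγ
  have hdisc : Valued.v (gw.trace ^ 2 - 4 * gw.det) < WithZero.exp (-2 : ℤ) := by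
    rw [hdiscg, Valuation.map_pow, hN, ← WithZero.exp_nsmul, WithZero.exp_lt_exp]
    simp only [smul_neg, nsmul_eq_mul, Nat.cast_ofNat]
    omega
  obtain ⟨-, -, -, -, hU2m, hU2p, hU1s, -, hU1m', hU1p', hU3⟩ := isUnit_shift_denominators_of_disc_lt L v w hw γH hσc hc h2 hg1 hu1 hdisc
  -- the shifted `H`-element on the carriers
  obtain ⟨g', hg'⟩ := exists_local_coe_eq_moebius L v 2 (Matrix.of fun i j : Fin 2 => if i.val + j.val + 1 = 2 then (1 : L) else 0) γH.1 hσc hU2m hU2p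
  obtain ⟨u', hu'⟩ := exists_local_coe_eq_moebius L v 1 (Matrix.of fun i j : Fin 1 => if i.val + j.val + 1 = 1 then (1 : L) else 0) γH.2 hσc hU1m' hU1p'
  have hN3 : IsUnit (((c + 1) • (((endoEmbLocal L v γH).val : GL (Fin 3) (LocalRing L v)).val : Matrix (Fin 3) (Fin 3) (LocalRing L v)) +
      (c - 1) • (1 : Matrix (Fin 3) (Fin 3) (LocalRing L v))).det) := by
    rw [coe_endoEmbLocal, coe_endoGL, smul_reindex_add_smul_one, smul_fromBlocks_add_smul_one, Matrix.det_reindex_self, Matrix.det_fromBlocks_zero₁₂]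
    exact hU2p.mul hU1p'
  have hu'eq := finGammaTwo_of_coe_eq_moebius L v γH (g', u') c hu'
  -- ★ N1 §3: the shifted binders
  obtain ⟨hα', hγ', hne', hN', hα1', hγ1', hn', hreg'⟩ :=
    shifted_binders_of_typeOne L v w hw γH (g', u') hσc hc h2 hg' hu'eq hg1 hu1 α γ hα hγ hαγ N hN h2N hα2 hγ2 hn2 hn
  -- `4c = (c+1)² − (c−1)²` is a unit of `E_v`
  have h4c : IsUnit ((c + 1) ^ 2 - (c - 1) ^ 2) := by
    refine isUnit_localRing_of_ne_zero_of_subsingleton L v hvs fun h0 => ?_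
    have hw0 := congrFun h0 w
    have e : ((c + 1) ^ 2 - (c - 1) ^ 2 : LocalRing L v) w = 2 * 2 * c w := by
      simp only [Pi.sub_apply, Pi.pow_apply, Pi.add_apply, Pi.one_apply]; ring
    rw [e, Pi.zero_apply] at hw0
    exact mul_ne_zero (mul_ne_zero (NeZero.ne 2) (NeZero.ne 2)) hc0 hw0
  -- ★ N4: non-Levi is preserved
  have hell' := not_levi_of_shift L v γH (g', u') h4c hg' hU2m hell
  -- the depth sum in `log` form
  have hm : WithZero.log (Valued.v (((finCharpolyTwo L v (g', u')).eval (finGammaTwo L v (g', u'))) w)) =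
      WithZero.log (Valued.v (((finCharpolyTwo L v γH).eval (finGammaTwo L v γH)) w)) + 2 := by
    rw [hn', hn, WithZero.log_exp, WithZero.log_exp]
    push_cast [Nat.cast_sub hn2]
    ring
  have hlt1 : ∀ {x : w.1.adicCompletion L}, Valued.v (x - 1) ≤ WithZero.exp (-2 : ℤ) → Valued.v (x - 1) < 1 :=
    fun {x} hx => valued_lt_one_of_le_exp_neg_two hx
  exact ⟨(g', u'), α, γ, _, _, N, n, hg', hu', hu'eq, hU2m, hU1m', hU1s, hU3, hN3, h4c, hreg', hell', hα, hγ, hαγ, hN, h2N, hlt1 hα2, hlt1 hγ2,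
    hα', hγ', hne', hN', hα1', hγ1', hn, hn2, hn', hm⟩


/-! ## §4 The type-(1) branch of organ (I) `stub_liftInterior`: `∃ u_H ∈ V′` with the two `S`-rows and the `Δ‴`-transport -/

open scoped Classical in
include hw in
set_option maxHeartbeats 1600000 in
-- the carriers' types and the strata indicators are large terms
/-- **ORGAN (I) `stub_liftInterior`, TYPE-(1) BRANCH** (END F0P3a-p03 (g16)'s N6 assembly `exact`s this in the branch `∃ x, χ_{g_w}(x) = 0`).  In the frame of the
fold's (I) text: `v` non-split unramified, `|2|_w = 1`, `μ` unramified at `w` restricting to `ω_{L∕L⁺}`; `c ∈ E_v` `σ`-fixed with `|c_w| = exp(−1)` (the END takes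
`c = ι_v(ϖ_v)`); the canonical families `mH`, `mG`; the level-2 piece `g`, its interior values `c′` and the level-1 piece `g′` enter only through the TRANSPORT HYPOTHESIS
`hF` (= ★-track N3 `classOrbitalIntegral_levelOneIndicator_eq_shift` of F0P2-p01 (g14), read at every shift `u_H` of `γ_H` with its denominators: `Φ(⟦x⟧, 1_{x_w ≡ 1}·g)
= Φ(⟦y⟧, g′)` for `x ↔ γ_H`, `y = φ_c(x)`), and N5b's «`u_H → 1`» through `hV` (★ `exists_level_forall_shift_mem_of_mem_nhds_one`, inner text VERBATIM) at a level
`j ≥ 1`.  CONCLUSION = the last block of (I) VERBATIM: for a `G`-regular non-Levi TYPE-(1) `γ_H` with `g_w ≡ 1`, `u_w ≡ 1 (mod c_w^{j+1})` there is `u_H ∈ V′`, `G`-regular,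
with `Φ^st(u_H, χ₀) = Φ^st(γ_H, χ₀) − q⁻¹Φ^st(γ_H, χ₁)`, `Φ^st(u_H, χ₁) = q⁻¹Φ^st(γ_H, χ₁)` (★ `stableOrbitalIntegralRel_chi_shift_of_isRoot` on §3's roots) and
`Σ_c Δ‴(γ_H, c)Φ(c, 1·g) = q⁻²·Σ_c Δ‴(u_H, c)Φ(c, g′)` (★ (A3) `finsum_finExplicitCollection_Δ_mul_eq_inv_sq_mul_finsum_shift` on §3's denominators and `hF`).
[cite: Rogawski1990, §4.9 Prop. 4.9.1 (a) p. 55; §4.3 (4.3.1)–(4.3.2) p. 43] [cite: Kottwitz1986, §3] [cite: LanglandsShelstad1987, §1.3] [cite: Flicker1998UnitaryFL, §6 p. 97] -/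
theorem liftInterior_shift_of_typeOne (H' : Matrix (Fin 3) (Fin 3) L) (μ : HeckeCharacter L)
    (hv : Algebra.IsUnramifiedIn (𝓞 L) v.asIdeal) (hμ : μ.IsUnramifiedAt w.1)
    (hμω : ∀ x : ideleGroup ↥(maximalRealSubfield L), μ (AdeleRing.ideleBaseChange ↥(maximalRealSubfield L) L x) = quadraticHeckeCharCM L x)
    (h2 : Valued.v (2 : w.1.adicCompletion L) = 1)
    [MeasurableSpace ((cmDatum L 2 (Matrix.of fun i j : Fin 2 => if i.val + j.val + 1 = 2 then (1 : L) else 0)).Local v × (cmDatum L 1 (Matrix.of fun i j : Fin 1 => if i.val + j.val + 1 = 1 then (1 : L) else 0)).Local v)] [BorelSpace ((cmDatum L 2 (Matrix.of fun i j : Fin 2 => if i.val + j.val + 1 = 2 then (1 : L) else 0)).Local v × (cmDatum L 1 (Matrix.of fun i j : Fin 1 => if i.val + j.val + 1 = 1 then (1 : L) else 0)).Local v)]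
    [∀ a : (cmDatum L 2 (Matrix.of fun i j : Fin 2 => if i.val + j.val + 1 = 2 then (1 : L) else 0)).Local v × (cmDatum L 1 (Matrix.of fun i j : Fin 1 => if i.val + j.val + 1 = 1 then (1 : L) else 0)).Local v, MeasurableSpace (((cmDatum L 2 (Matrix.of fun i j : Fin 2 => if i.val + j.val + 1 = 2 then (1 : L) else 0)).Local v × (cmDatum L 1 (Matrix.of fun i j : Fin 1 => if i.val + j.val + 1 = 1 then (1 : L) else 0)).Local v) ⧸ Subgroup.centralizer ({a} : Set ((cmDatum L 2 (Matrix.of fun i j : Fin 2 => if i.val + j.val + 1 = 2 then (1 : L) else 0)).Local v × (cmDatum L 1 (Matrix.of fun i j : Fin 1 => if i.val + j.val + 1 = 1 then (1 : L) else 0)).Local v)))]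
    [∀ a : (cmDatum L 2 (Matrix.of fun i j : Fin 2 => if i.val + j.val + 1 = 2 then (1 : L) else 0)).Local v × (cmDatum L 1 (Matrix.of fun i j : Fin 1 => if i.val + j.val + 1 = 1 then (1 : L) else 0)).Local v, BorelSpace (((cmDatum L 2 (Matrix.of fun i j : Fin 2 => if i.val + j.val + 1 = 2 then (1 : L) else 0)).Local v × (cmDatum L 1 (Matrix.of fun i j : Fin 1 => if i.val + j.val + 1 = 1 then (1 : L) else 0)).Local v) ⧸ Subgroup.centralizer ({a} : Set ((cmDatum L 2 (Matrix.of fun i j : Fin 2 => if i.val + j.val + 1 = 2 then (1 : L) else 0)).Local v × (cmDatum L 1 (Matrix.of fun i j : Fin 1 => if i.val + j.val + 1 = 1 then (1 : L) else 0)).Local v)))]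
    (νH : Measure ((cmDatum L 2 (Matrix.of fun i j : Fin 2 => if i.val + j.val + 1 = 2 then (1 : L) else 0)).Local v × (cmDatum L 1 (Matrix.of fun i j : Fin 1 => if i.val + j.val + 1 = 1 then (1 : L) else 0)).Local v)) [νH.IsHaarMeasure] [νH.IsMulRightInvariant]
    {mH : OrbitalMeasureFamily ((cmDatum L 2 (Matrix.of fun i j : Fin 2 => if i.val + j.val + 1 = 2 then (1 : L) else 0)).Local v × (cmDatum L 1 (Matrix.of fun i j : Fin 1 => if i.val + j.val + 1 = 1 then (1 : L) else 0)).Local v)} (hmH : mH.IsCanonical (IsLocalGRegular L v) νH)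
    [∀ γ : ((cmDatum L 3 H').Local v), MeasurableSpace (((cmDatum L 3 H').Local v) ⧸ Subgroup.centralizer ({γ} : Set ((cmDatum L 3 H').Local v)))]
    {mG : OrbitalMeasureFamily ((cmDatum L 3 H').Local v)}
    (g g' : ((cmDatum L 3 H').Local v) → ℂ)
    {c : LocalRing L v} (hσc : conjLocal L (IsCMField.complexConj L) v c = c) (hc : Valued.v (c w) = WithZero.exp (-1 : ℤ))
    {V' : Set ((cmDatum L 2 (Matrix.of fun i j : Fin 2 => if i.val + j.val + 1 = 2 then (1 : L) else 0)).Local v × (cmDatum L 1 (Matrix.of fun i j : Fin 1 => if i.val + j.val + 1 = 1 then (1 : L) else 0)).Local v)} {j : ℕ} (hj : 1 ≤ j)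
    (hV : ∀ γH uH : ((cmDatum L 2 (Matrix.of fun i j : Fin 2 => if i.val + j.val + 1 = 2 then (1 : L) else 0)).Local v × (cmDatum L 1 (Matrix.of fun i j : Fin 1 => if i.val + j.val + 1 = 1 then (1 : L) else 0)).Local v),
      (∀ i k, Valued.v (((((γH.1.val : GL (Fin 2) (LocalRing L v)).val : Matrix (Fin 2) (Fin 2) (LocalRing L v))).map (Pi.evalRingHom (fun w' : PlacesOver L v => w'.1.adicCompletion L) w) - 1) i k) ≤ Valued.v (c w) ^ (j + 1)) →
      Valued.v (finGammaTwo L v γH w - 1) ≤ Valued.v (c w) ^ (j + 1) →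
      IsUnit ((c - 1) • ((γH.1.val : GL (Fin 2) (LocalRing L v)).val : Matrix (Fin 2) (Fin 2) (LocalRing L v)) + (c + 1) • (1 : Matrix (Fin 2) (Fin 2) (LocalRing L v))).det →
      IsUnit ((c - 1) * finGammaTwo L v γH + (c + 1)) →
      ((uH.1.val : GL (Fin 2) (LocalRing L v)).val : Matrix (Fin 2) (Fin 2) (LocalRing L v)) =
        ((c + 1) • ((γH.1.val : GL (Fin 2) (LocalRing L v)).val : Matrix (Fin 2) (Fin 2) (LocalRing L v)) + (c - 1) • 1) *
          ((c - 1) • ((γH.1.val : GL (Fin 2) (LocalRing L v)).val : Matrix (Fin 2) (Fin 2) (LocalRing L v)) + (c + 1) • 1)⁻¹ →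
      finGammaTwo L v uH = ((c + 1) * finGammaTwo L v γH + (c - 1)) * Ring.inverse ((c - 1) * finGammaTwo L v γH + (c + 1)) →
      uH ∈ V')
    {γH : (cmDatum L 2 (Matrix.of fun i j : Fin 2 => if i.val + j.val + 1 = 2 then (1 : L) else 0)).Local v × (cmDatum L 1 (Matrix.of fun i j : Fin 1 => if i.val + j.val + 1 = 1 then (1 : L) else 0)).Local v}
    (hgl : ∀ i k, Valued.v ((((γH.1.val : GL (Fin 2) (LocalRing L v)).val.map (Pi.evalRingHom (fun w' : PlacesOver L v => w'.1.adicCompletion L) w)) - 1) i k) ≤ Valued.v (c w) ^ (j + 1))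
    (hul : Valued.v (finGammaTwo L v γH w - 1) ≤ Valued.v (c w) ^ (j + 1))
    (hreg : IsLocalGRegular L v γH)
    (hell : ¬ (∃ (y : ((cmDatum L 2 (Matrix.of fun i j : Fin 2 => if i.val + j.val + 1 = 2 then (1 : L) else 0)).Local v × (cmDatum L 1 (Matrix.of fun i j : Fin 1 => if i.val + j.val + 1 = 1 then (1 : L) else 0)).Local v)) (d' : Fin 2 → (UnitaryGroup.LocalRing L v)ˣ),
          glDiagonal 2 (UnitaryGroup.LocalRing L v) d' = ((y * γH * y⁻¹).1.val : GL (Fin 2) (UnitaryGroup.LocalRing L v))))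
    (hsplit : ∃ x : w.1.adicCompletion L, (((γH.1.val : GL (Fin 2) (LocalRing L v)).val.map
        (Pi.evalRingHom (fun w' : PlacesOver L v => w'.1.adicCompletion L) w)).charpoly).IsRoot x)
    (hF : IsUnit ((c - 1) • ((γH.1.val : GL (Fin 2) (LocalRing L v)).val : Matrix (Fin 2) (Fin 2) (LocalRing L v)) + (c + 1) • (1 : Matrix (Fin 2) (Fin 2) (LocalRing L v))).det →
      IsUnit ((c - 1) • ((γH.2.val : GL (Fin 1) (LocalRing L v)).val : Matrix (Fin 1) (Fin 1) (LocalRing L v)) + (c + 1) • (1 : Matrix (Fin 1) (Fin 1) (LocalRing L v))).det →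
      ∀ uH : (cmDatum L 2 (Matrix.of fun i j : Fin 2 => if i.val + j.val + 1 = 2 then (1 : L) else 0)).Local v × (cmDatum L 1 (Matrix.of fun i j : Fin 1 => if i.val + j.val + 1 = 1 then (1 : L) else 0)).Local v, IsLocalGRegular L v uH →
      ((uH.1.val : GL (Fin 2) (LocalRing L v)).val : Matrix (Fin 2) (Fin 2) (LocalRing L v)) =
        ((c + 1) • ((γH.1.val : GL (Fin 2) (LocalRing L v)).val : Matrix (Fin 2) (Fin 2) (LocalRing L v)) + (c - 1) • 1) *
          ((c - 1) • ((γH.1.val : GL (Fin 2) (LocalRing L v)).val : Matrix (Fin 2) (Fin 2) (LocalRing L v)) + (c + 1) • 1)⁻¹ →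
      ((uH.2.val : GL (Fin 1) (LocalRing L v)).val : Matrix (Fin 1) (Fin 1) (LocalRing L v)) =
        ((c + 1) • ((γH.2.val : GL (Fin 1) (LocalRing L v)).val : Matrix (Fin 1) (Fin 1) (LocalRing L v)) + (c - 1) • 1) *
          ((c - 1) • ((γH.2.val : GL (Fin 1) (LocalRing L v)).val : Matrix (Fin 1) (Fin 1) (LocalRing L v)) + (c + 1) • 1)⁻¹ →
      ∀ x y : (cmDatum L 3 H').Local v, IsLocalNormPair L H' v γH x →
      ((y.val : GL (Fin 3) (LocalRing L v)).val : Matrix (Fin 3) (Fin 3) (LocalRing L v)) =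
        ((c + 1) • ((x.val : GL (Fin 3) (LocalRing L v)).val : Matrix (Fin 3) (Fin 3) (LocalRing L v)) + (c - 1) • 1) *
          ((c - 1) • ((x.val : GL (Fin 3) (LocalRing L v)).val : Matrix (Fin 3) (Fin 3) (LocalRing L v)) + (c + 1) • 1)⁻¹ →
      classOrbitalIntegral mG ({x : (cmDatum L 3 H').Local v | (∀ a b, Valued.v (((toPlace v w (HeckeCharacter.uniformizer ↥(maximalRealSubfield L) v : v.adicCompletion ↥(maximalRealSubfield L))) ^ 1)⁻¹ *
        ((((localNonsplitEquiv (IsCMField.complexConj L) H' (IsCMField.complexConj_ne_one L) w hw (x) :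
            ↥(unitaryGroupOfForm (galAdicCompletionMap (L := L) (IsCMField.complexConj L) hw) (placeForm H' w.1))) : GL (Fin 3) (w.1.adicCompletion L)) :
              Matrix (Fin 3) (Fin 3) (w.1.adicCompletion L)) a b - (1 : Matrix (Fin 3) (Fin 3) (w.1.adicCompletion L)) a b)) ≤ 1)}.indicator g) (ConjClasses.mk x) =
        classOrbitalIntegral mG g' (ConjClasses.mk y)) :
    ∃ uH ∈ V', IsLocalGRegular L v uH ∧
          stableOrbitalIntegralRel (IsLocalStablyConjH L v) mH (((((cmLocalIntegralLevel L 2 (Matrix.of fun i j : Fin 2 => if i.val + j.val + 1 = 2 then (1 : L) else 0) v).prod (cmLocalIntegralLevel L 1 (Matrix.of fun i j : Fin 1 => if i.val + j.val + 1 = 1 then (1 : L) else 0) v)) : Subgroup ((cmDatum L 2 (Matrix.of fun i j : Fin 2 => if i.val + j.val + 1 = 2 then (1 : L) else 0)).Local v × (cmDatum L 1 (Matrix.of fun i j : Fin 1 => if i.val + j.val + 1 = 1 then (1 : L) else 0)).Local v)) : Set ((cmDatum L 2 (Matrix.of fun i j : Fin 2 => if i.val + j.val + 1 = 2 then (1 :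 L) else 0)).Local v × (cmDatum L 1 (Matrix.of fun i j : Fin 1 => if i.val + j.val + 1 = 1 then (1 : L) else 0)).Local v)).indicator fun h => if (redMat (((h).1.val : GL (Fin 2) (UnitaryGroup.LocalRing L v)).val.map (Pi.evalRingHom (fun w' : PlacesOver L v => w'.1.adicCompletion L) w)) - 1) ^ 2 = 0 ∧ (redMat (((h).1.val : GL (Fin 2) (UnitaryGroup.LocalRing L v)).val.map (Pi.evalRingHom (fun w' : PlacesOver L v => w'.1.adicCompletion L) w)) - 1).rank = 0 then (1 : ℂ) else 0) uH =
            stableOrbitalIntegralRel (IsLocalStablyConjH L v) mH (((((cmLocalIntegralLevel L 2 (Matrix.of fun i j : Fin 2 => if i.val + j.val + 1 = 2 then (1 : L) else 0) v).prod (cmLocalIntegralLevel L 1 (Matrix.of fun i j : Fin 1 => if i.val + j.val + 1 = 1 then (1 : L) else 0) v)) : Subgroup ((cmDatum L 2 (Matrix.of fun i j : Fin 2 => if i.val + j.val + 1 = 2 then (1 : L) else 0)).Local v × (cmDatum L 1 (Matrix.of fun i j : Fin 1 => if i.val + j.val + 1 = 1 then (1 : L) else 0)).Local v)) : Set ((cmDatum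 L 2 (Matrix.of fun i j : Fin 2 => if i.val + j.val + 1 = 2 then (1 : L) else 0)).Local v × (cmDatum L 1 (Matrix.of fun i j : Fin 1 => if i.val + j.val + 1 = 1 then (1 : L) else 0)).Local v)).indicator fun h => if (redMat (((h).1.val : GL (Fin 2) (UnitaryGroup.LocalRing L v)).val.map (Pi.evalRingHom (fun w' : PlacesOver L v => w'.1.adicCompletion L) w)) - 1) ^ 2 = 0 ∧ (redMat (((h).1.val : GL (Fin 2) (UnitaryGroup.LocalRing L v)).val.map (Pi.evalRingHom (fun w' : PlacesOver L v => w'.1.adicCompletion L) w)) - 1).rank = 0 then (1 : ℂ) else 0) γH -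
              ((Ideal.absNorm v.asIdeal : ℕ) : ℂ)⁻¹ * stableOrbitalIntegralRel (IsLocalStablyConjH L v) mH (((((cmLocalIntegralLevel L 2 (Matrix.of fun i j : Fin 2 => if i.val + j.val + 1 = 2 then (1 : L) else 0) v).prod (cmLocalIntegralLevel L 1 (Matrix.of fun i j : Fin 1 => if i.val + j.val + 1 = 1 then (1 : L) else 0) v)) : Subgroup ((cmDatum L 2 (Matrix.of fun i j : Fin 2 => if i.val + j.val + 1 = 2 then (1 : L) else 0)).Local v × (cmDatum L 1 (Matrix.of fun i j : Fin 1 => if i.val + j.val + 1 = 1 then (1 : L) else 0)).Local v)) : Set ((cmDatum L 2 (Matrix.of fun i j : Fin 2 => if i.val + j.val + 1 = 2 then (1 : L) else 0)).Local v × (cmDatum L 1 (Matrix.of fun i j : Fin 1 => if i.val + j.val + 1 = 1 then (1 : L) else 0)).Local v)).indicator fun h => if (redMat (((h).1.val : GL (Fin 2) (UnitaryGroup.LocalRing L v)).val.map (Pi.evalRingHom (fun w' : PlacesOver L v => w'.1.adicCompletion L) w)) - 1) ^ 2 = 0 ∧ (redMat (((h).1.val : GL (Fin 2) (UnitaryGroup.LocalRing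 L v)).val.map (Pi.evalRingHom (fun w' : PlacesOver L v => w'.1.adicCompletion L) w)) - 1).rank = 1 then (1 : ℂ) else 0) γH ∧
          stableOrbitalIntegralRel (IsLocalStablyConjH L v) mH (((((cmLocalIntegralLevel L 2 (Matrix.of fun i j : Fin 2 => if i.val + j.val + 1 = 2 then (1 : L) else 0) v).prod (cmLocalIntegralLevel L 1 (Matrix.of fun i j : Fin 1 => if i.val + j.val + 1 = 1 then (1 : L) else 0) v)) : Subgroup ((cmDatum L 2 (Matrix.of fun i j : Fin 2 => if i.val + j.val + 1 = 2 then (1 : L) else 0)).Local v × (cmDatum L 1 (Matrix.of fun i j : Fin 1 => if i.val + j.val + 1 = 1 then (1 : L) else 0)).Local v)) : Set ((cmDatum L 2 (Matrix.of fun i j : Fin 2 => if i.val + j.val + 1 = 2 then (1 : L) else 0)).Local v × (cmDatum L 1 (Matrix.of fun i j : Fin 1 => if i.val + j.val + 1 = 1 then (1 : L) else 0)).Local v)).indicator fun h => if (redMat (((h).1.val : GL (Fin 2) (UnitaryGroup.LocalRing L v)).val.map (Pi.evalRingHom (fun w' : PlacesOver L v => w'.1.adicCompletion L) w)) - 1)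 ^ 2 = 0 ∧ (redMat (((h).1.val : GL (Fin 2) (UnitaryGroup.LocalRing L v)).val.map (Pi.evalRingHom (fun w' : PlacesOver L v => w'.1.adicCompletion L) w)) - 1).rank = 1 then (1 : ℂ) else 0) uH =
            ((Ideal.absNorm v.asIdeal : ℕ) : ℂ)⁻¹ * stableOrbitalIntegralRel (IsLocalStablyConjH L v) mH (((((cmLocalIntegralLevel L 2 (Matrix.of fun i j : Fin 2 => if i.val + j.val + 1 = 2 then (1 : L) else 0) v).prod (cmLocalIntegralLevel L 1 (Matrix.of fun i j : Fin 1 => if i.val + j.val + 1 = 1 then (1 : L) else 0) v)) : Subgroup ((cmDatum L 2 (Matrix.of fun i j : Fin 2 => if i.val + j.val + 1 = 2 then (1 : L) else 0)).Local v × (cmDatum L 1 (Matrix.of fun i j : Fin 1 => if i.val + j.val + 1 = 1 then (1 : L) else 0)).Local v)) : Set ((cmDatum L 2 (Matrix.of fun i j : Fin 2 => if i.val + j.val + 1 = 2 then (1 : L) else 0)).Local v × (cmDatum L 1 (Matrix.of fun i j : Fin 1 => if i.val + j.val + 1 = 1 then (1 : L) else 0)).Local v)).indicator fun h => if (redMat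 (((h).1.val : GL (Fin 2) (UnitaryGroup.LocalRing L v)).val.map (Pi.evalRingHom (fun w' : PlacesOver L v => w'.1.adicCompletion L) w)) - 1) ^ 2 = 0 ∧ (redMat (((h).1.val : GL (Fin 2) (UnitaryGroup.LocalRing L v)).val.map (Pi.evalRingHom (fun w' : PlacesOver L v => w'.1.adicCompletion L) w)) - 1).rank = 1 then (1 : ℂ) else 0) γH ∧
          (∑ᶠ cG : ConjClasses ((cmDatum L 3 H').Local v),
            ((finExplicitCollection L H' μ (finExplicitDelta_conj_left_all L H' μ) (finExplicitDelta_conj_right_all L H' μ)) v).Δ γH (Quotient.out cG) *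
              classOrbitalIntegral mG ({x : (cmDatum L 3 H').Local v | (∀ a b, Valued.v (((toPlace v w (HeckeCharacter.uniformizer ↥(maximalRealSubfield L) v : v.adicCompletion ↥(maximalRealSubfield L))) ^ 1)⁻¹ *
        ((((localNonsplitEquiv (IsCMField.complexConj L) H' (IsCMField.complexConj_ne_one L) w hw (x) :
            ↥(unitaryGroupOfForm (galAdicCompletionMap (L := L) (IsCMField.complexConj L) hw) (placeForm H' w.1))) : GL (Fin 3) (w.1.adicCompletion L)) :
              Matrix (Fin 3) (Fin 3) (w.1.adicCompletion L)) a b - (1 : Matrix (Fin 3) (Fin 3) (w.1.adicCompletion L)) a b)) ≤ 1)}.indicator g) cG) =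
            (((Ideal.absNorm v.asIdeal : ℕ) : ℂ) ^ 2)⁻¹ *
            (∑ᶠ cG : ConjClasses ((cmDatum L 3 H').Local v),
            ((finExplicitCollection L H' μ (finExplicitDelta_conj_left_all L H' μ) (finExplicitDelta_conj_right_all L H' μ)) v).Δ uH (Quotient.out cG) *
              classOrbitalIntegral mG g' cG) := by
  -- §3: the shift and its binders
  obtain ⟨uH, α, γ, α', γ', N, n, h1, h2', hu', hD1, hD2, hμ₂, hD, hN3, h4c, hreg', hell', hα, hγ, hαγ, hN, h2N, hα1, hγ1,
    hα', hγ', hαγ', hN', hα1', hγ1', -, -, -, hm⟩ :=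
    exists_typeOne_shift L v w hw h2 hσc hc hreg hell hsplit hj hgl hul
  refine ⟨uH, hV γH uH hgl hul hD1 hμ₂ h1 hu', hreg', ?_, ?_, ?_⟩
  -- the two `S`-rows (★ END p846474)
  · exact (stableOrbitalIntegralRel_chi_shift_of_isRoot L v w hw νH hv hmH hreg hell α γ hα hγ hαγ N hN hα1 hγ1 hreg' hell' α' γ' hα' hγ' hαγ' hN' hα1' hγ1' h2N
      _ _).1
  · -- (`χdec₀` does not occur in the second row: any instance)
    exact (stableOrbitalIntegralRel_chi_shift_of_isRoot L v w hw νH hv hmH hreg hell α γ hα hγ hαγ N hN hα1 hγ1 hreg' hell' α' γ' hα' hγ' hαγ' hN' hα1' hγ1' h2N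
      (fun _ => inferInstance) _).2
  -- the `Δ‴`-transport (★ (A3) p846531) along `hF`
  · exact finsum_finExplicitCollection_Δ_mul_eq_inv_sq_mul_finsum_shift L v H' w hw c γH uH μ hμω hv hμ hσc h4c hreg hreg' h1 h2' hD1 hD2 hD hN3 hμ₂ hm _ _
      (hF hD1 hD2 uH hreg' h1 h2')

end Literature.NumberTheory.Rogawski1990

end
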